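import Mathlib

/-!
# Route `AntiScreeningCeilings` — LINE C rung for the repaired crux `SubhomogeneousSpectralMeasureR` (stmt-QuantumFields-27501):
# the transfer-matrix PAIRING IDENTITY behind the representation clause (i)

D-0145 ideator seat ym-idea-11 (generation g4, lens «wuc»).  In the eigenbasis of a positive transfer matrix with eigenvalues
`d i > 0` (time extent `N`, insertion `Q` real symmetric = the plaquette operator or the symmetric straddling kernel), the torus
two-point function is `F(t) = Σ_{i,j} d_i^{N-t} d_j^{t} Q_{ij}²`.  We prove the exact PAIRING IDENTITY
`2 F(t) = Σ_{i,j} Q_{ij}² · max(d_i,d_j)^N · (e^{-E_{ij} t} + e^{-E_{ij}(N-t)})`, `E_{ij} = |log d_i - log d_j| ≥ 0`,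
i.e. `F` is a finite positive combination of symmetrised exponentials with non-negative pair energies: the `E_{ij} > 0` pairs form the
finite positive measure `ν` of clause (i), the `E_{ij} = 0` pairs (diagonal and degenerate) the constant; and the DIAGONAL VARIANCE bound
`(Σ p_i x_i)² ≤ Σ p_i x_i²` (`p` a probability vector) which makes the constant `κ₀` of the CONNECTED function non-negative.
This is the finite-dimensional skeleton of idea-crit-9's re-derivation (VERDICT #33 (a)); the lattice statement needs Lüscher's transfer matrix
(CMP 54, 1977) / Osterwalder–Seiler reflection positivity on the finite torus, which is NOT formalised here.  Mathlib only; proves no crux.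
-/

namespace Summit.QuantumFields.YangMills.Cruxes.SubhomogeneousSpectralMeasureR.Rung

open Finset

/-- one pair `{a, b}` of positive eigenvalues, oriented form: `a^{N-t} b^t + b^{N-t} a^t = a^N (e^{-Et} + e^{-E(N-t)})`, `E = log a - log b`
(an identity for any positive `a, b`; `E ≥ 0` iff `b ≤ a`). -/
theorem pair_term_of_le (a b : ℝ) (ha : 0 < a) (hb : 0 < b) (t N : ℕ) (ht : t ≤ N) :
    a ^ (N - t) * b ^ t + b ^ (N - t) * a ^ t =
      a ^ N * (Real.exp (-((Real.log a - Real.log b) * t)) + Real.exp (-((Real.log a - Real.log b) * ((N - t : ℕ) : ℝ)))) := by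
  have hq : ∀ m : ℕ, Real.exp (-((Real.log a - Real.log b) * (m : ℝ))) = (b / a) ^ m := by
    intro m
    rw [show -((Real.log a - Real.log b) * (m : ℝ)) = (m : ℝ) * (Real.log b - Real.log a) by ring, Real.exp_nat_mul,
      Real.exp_sub, Real.exp_log hb, Real.exp_log ha]
  rw [hq t, hq (N - t)]
  have hsplit1 : a ^ N = a ^ (N - t) * a ^ t := by rw [← pow_add, Nat.sub_add_cancel ht]
  have hk : ∀ m : ℕ, a ^ m * (b / a) ^ m = b ^ m := by
    intro m; rw [← mul_pow, mul_div_cancel₀ b ha.ne']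
  calc a ^ (N - t) * b ^ t + b ^ (N - t) * a ^ t
      = a ^ (N - t) * (a ^ t * (b / a) ^ t) + a ^ t * (a ^ (N - t) * (b / a) ^ (N - t)) := by rw [hk t, hk (N - t)]; ring
    _ = a ^ N * ((b / a) ^ t + (b / a) ^ (N - t)) := by rw [hsplit1]; ring

/-- the symmetric form of `pair_term_of_le` (no order hypothesis). -/
theorem pair_term (a b : ℝ) (ha : 0 < a) (hb : 0 < b) (t N : ℕ) (ht : t ≤ N) :
    a ^ (N - t) * b ^ t + b ^ (N - t) * a ^ t =
      (max a b) ^ N * (Real.exp (-(|Real.log a - Real.log b| * t)) + Real.exp (-(|Real.log a - Real.log b| * ((N - t : ℕ) : ℝ)))) := by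
  rcases le_total b a with hba | hab
  · have hlog : 0 ≤ Real.log a - Real.log b := by linarith [Real.log_le_log hb hba]
    rw [max_eq_left hba, abs_of_nonneg hlog]
    exact pair_term_of_le a b ha hb t N ht
  · have hlog : Real.log a - Real.log b ≤ 0 := by linarith [Real.log_le_log ha hab]
    rw [max_eq_right hab, abs_of_nonpos hlog, neg_sub, add_comm]
    exact pair_term_of_le b a hb ha t N ht

/-- **Pairing identity.**  `2 F(t) = Σ_{i,j} Q_{ij}² max(d_i,d_j)^N (e^{-E_{ij}t} + e^{-E_{ij}(N-t)})` with `E_{ij} = |log d_i - log d_j|`. -/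
theorem pairing_identity {n : ℕ} (N t : ℕ) (ht : t ≤ N) (d : Fin n → ℝ) (hd : ∀ i, 0 < d i)
    (Q : Fin n → Fin n → ℝ) (hQ : ∀ i j, Q i j = Q j i) :
    2 * ∑ i, ∑ j, d i ^ (N - t) * d j ^ t * Q i j ^ 2 =
      ∑ i, ∑ j, Q i j ^ 2 * ((max (d i) (d j)) ^ N *
        (Real.exp (-(|Real.log (d i) - Real.log (d j)| * t)) + Real.exp (-(|Real.log (d i) - Real.log (d j)| * ((N - t : ℕ) : ℝ))))) := by
  have hpair : ∀ i j, Q i j ^ 2 * ((max (d i) (d j)) ^ N *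
        (Real.exp (-(|Real.log (d i) - Real.log (d j)| * t)) + Real.exp (-(|Real.log (d i) - Real.log (d j)| * ((N - t : ℕ) : ℝ)))))
      = Q i j ^ 2 * (d i ^ (N - t) * d j ^ t) + Q i j ^ 2 * (d j ^ (N - t) * d i ^ t) := by
    intro i j; rw [← pair_term (d i) (d j) (hd i) (hd j) t N ht]; ring
  simp_rw [hpair, Finset.sum_add_distrib]
  have hswap : ∑ i, ∑ j, Q i j ^ 2 * (d j ^ (N - t) * d i ^ t) = ∑ i, ∑ j, Q i j ^ 2 * (d i ^ (N - t) * d j ^ t) := by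
    rw [Finset.sum_comm]
    exact Finset.sum_congr rfl fun i _ => Finset.sum_congr rfl fun j _ => by rw [hQ]
  have hA : ∑ i, ∑ j, d i ^ (N - t) * d j ^ t * Q i j ^ 2 = ∑ i, ∑ j, Q i j ^ 2 * (d i ^ (N - t) * d j ^ t) :=
    Finset.sum_congr rfl fun i _ => Finset.sum_congr rfl fun j _ => by ring
  rw [hswap, hA]; ring

/-- every weight `Q_{ij}² max(d_i,d_j)^N / 2` is non-negative and every pair energy `|log d_i - log d_j|` is non-negative:
the `E > 0` pairs give the positive measure of clause (i), the `E = 0` pairs the constant. -/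
theorem pairing_weights_nonneg {n : ℕ} (N : ℕ) (d : Fin n → ℝ) (hd : ∀ i, 0 < d i) (Q : Fin n → Fin n → ℝ) (i j : Fin n) :
    0 ≤ Q i j ^ 2 * (max (d i) (d j)) ^ N / 2 ∧ 0 ≤ |Real.log (d i) - Real.log (d j)| :=
  ⟨by have := hd i; positivity, abs_nonneg _⟩

/-- **Diagonal variance.**  For a probability vector `p` and diagonal entries `x`, `(Σ p_i x_i)² ≤ Σ p_i x_i²` (Cauchy–Schwarz):
the constant of the CONNECTED two-point function, `Σ_{E=0} w - (Σ_i p_i Q_{ii})²·Z ≥ Σ_i p_i Q_{ii}² - (Σ_i p_i Q_{ii})² ≥ 0`. -/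
theorem diag_variance_nonneg {n : ℕ} (p x : Fin n → ℝ) (hp : ∀ i, 0 ≤ p i) (hp1 : ∑ i, p i = 1) :
    (∑ i, p i * x i) ^ 2 ≤ ∑ i, p i * x i ^ 2 := by
  have hcs := Finset.sum_mul_sq_le_sq_mul_sq (Finset.univ : Finset (Fin n)) (fun i => Real.sqrt (p i)) (fun i => Real.sqrt (p i) * x i)
  have h1 : ∀ i, Real.sqrt (p i) * (Real.sqrt (p i) * x i) = p i * x i := fun i => by
    rw [← mul_assoc, Real.mul_self_sqrt (hp i)]
  have h2 : ∀ i, Real.sqrt (p i) ^ 2 = p i := fun i => Real.sq_sqrt (hp i)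
  have h3 : ∀ i, (Real.sqrt (p i) * x i) ^ 2 = p i * x i ^ 2 := fun i => by rw [mul_pow, Real.sq_sqrt (hp i)]
  simp only [h1, h2, h3, hp1, one_mul] at hcs
  exact hcs

end Summit.QuantumFields.YangMills.Cruxes.SubhomogeneousSpectralMeasureR.Rung
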